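import Summits.CriticalPhenomena.PercolationContinuityZ3.Theorems.Transplant.FKConnectivityAllQSPUpCorr
import Summits.CriticalPhenomena.PercolationContinuityZ3.Theorems.Transplant.FKConnectivityAllQTwoSumLaws
import HarnessLib

/-!
# Connectivity correlation inequalities for `φ_{w,q}`, every `q > 0` — file 14e: NEGATIVE ASSOCIATION ACROSS A TWO-VERTEX SEPARATION
# (`0 < q ≤ 1`): increasing events of the two sides of a parallel composition of two-terminal series–parallel networks are negatively
# correlated — an exact identity

Support file (`--supports stmt-CriticalPhenomena-4575`), FK sub-lane `prim-bschramm-fk-2` (gen 8) of the post-continuity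
programme; builds on p205010 (kernel theorem, internal audit signed; external expert review pending).  No definitions, no named
facts, no sorries; standard axioms.

Let `E = E₁ ∪ E₂` be a PARALLEL composition (edge-disjoint parts whose vertex sets meet inside `{s, t}`), `C = {s ↔ t}` read on each
part, and let `M₁`, `M₂` be events LOCAL to the first / second part.  With the part masses `cᵢ = NMᵢ(C ∩ Mᵢ)`, `dᵢ = NMᵢ(Cᶜ ∩ Mᵢ)`,
`Cᵢ = NMᵢ(C)`, `Dᵢ = NMᵢ(Cᶜ)` (`FK.netMass`), fk-1 g6's two-mark parallel law (`FK.netMass_parallel_two`, `…AllQTwoSumLaws.lean`)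
reads `q^{|V|}·NM_E(M₁ ∩ M₂) = q·c₁c₂ + c₁d₂ + d₁c₂ + d₁d₂`.  Hence:
* **`FK.twoSep_defect_eq`** — the EXACT IDENTITY
  `[q^{|V|}NM(M₁)]·[q^{|V|}NM(M₂)] − [q^{|V|}NM(M₁ ∩ M₂)]·[q^{|V|}NM(Ω)] = (1 − q)·(c₁D₁ − d₁C₁)·(c₂D₂ − d₂C₂)`:
  the (unnormalised) covariance of two events separated by `{s, t}` is `−(1−q)` times the product of the two sides' UPC-defects
  (`cᵢDᵢ − dᵢCᵢ ≥ 0` iff conditioning on `s ↔ t` raises `Mᵢ` inside part `i`).  At `q = 1` the sides are independent; for `q > 1` the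
  sign flips.  With `Mᵢ = J_{eᵢ}` the defects are the EC⁺ brackets of gen 6/7 and the identity is the two-sum step of Wagner's theorem.
* `FK.twoSep_alg` — `q ≤ 1` and both defects `≥ 0` ⇒ `NM(M₁ ∩ M₂)·NM(Ω) ≤ NM(M₁)·NM(M₂)`.
* **`FK.twoSep_negAssoc_of_isTTSP`** (`0 < q ≤ 1`): if both parts are two-terminal series–parallel networks between `s` and `t`
  (`FK.IsTTSP`), `w` is supported in `E₁ ∪ E₂`, and `M₁`, `M₂` are INCREASING events local to the two parts, then
  `φ_{w,q}(M₁ ∩ M₂) ≤ φ_{w,q}(M₁)·φ_{w,q}(M₂)` — NEGATIVE ASSOCIATION in Grimmett's second sense (2006 §3.9: `μ(A ∩ B) ≤ μ(A)μ(B)` for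
  increasing `A`, `B` defined on complementary edge sets) for every complementary pair of edge sets forming a parallel two-terminal
  separation with series–parallel sides; the UPC-defects are `≥ 0` by `FK.upcNet_of_isTTSP` (file 14b).  `M₂ = J_e` (`E₂` a single
  edge) is the single-edge negative dependence of `…AllQSPNegDep.lean`; a ONE-vertex separation gives independence
  (`FK.rcMeasureW_real_inter_eq_mul_of_cutVertex`, gen 7).  Unconditional; new for `q < 1` as far as searched.
[cite: Grimmett2006, §3.9 (pp. 63–64); §3.8 Thm. (3.91) (p. 62); §1.4 eq. (1.20) (p. 15)] [cite: Wagner2006, Prop. 5.6, Cor. 5.7, Thm. 5.8(d)]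
[cite: BorceaBrandenLiggett2007, §2.1, Conj. 2.6]
-/

noncomputable section

namespace Summit.CriticalPhenomena.PercolationContinuityZ3.Theorems

namespace FK

open MeasureTheory SimpleGraph Literature.Probability.LatticeModels Literature.Probability.Percolation
open Literature.Probability.Percolation.DecisionTree (ind ind_of_mem ind_of_not_mem ind_nonneg)
open scoped Classical

variable {V : Type*} [Fintype V]

/-! ### The identity and the inequality -/

omit [Fintype V] in
/-- **Covariance across a two-vertex separation = `−(1−q)` × product of the UPC-defects of the sides** (pure algebra on the
two-mark law): with `X·N₁₂ = q c₁c₂ + c₁d₂ + d₁c₂ + d₁d₂` and its three specialisations,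
`(X N₁)(X N₂) − (X N₁₂)(X N₀) = (1 − q)(c₁D₁ − d₁C₁)(c₂D₂ − d₂C₂)`. [cite: Wagner2006, Prop. 5.6, Cor. 5.7 (pp. 13–14)]
[cite: Grimmett2006, §3.9 (pp. 63–64)] -/
theorem twoSep_defect_eq {X q N12 N1 N2 N0 c1 d1 C1 D1 c2 d2 C2 D2 : ℝ}
    (e12 : X * N12 = q * (c1 * c2) + c1 * d2 + d1 * c2 + d1 * d2)
    (e1 : X * N1 = q * (c1 * C2) + c1 * D2 + d1 * C2 + d1 * D2)
    (e2 : X * N2 = q * (C1 * c2) + C1 * d2 + D1 * c2 + D1 * d2)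
    (e0 : X * N0 = q * (C1 * C2) + C1 * D2 + D1 * C2 + D1 * D2) :
    (X * N1) * (X * N2) - (X * N12) * (X * N0) = (1 - q) * (c1 * D1 - d1 * C1) * (c2 * D2 - d2 * C2) := by
  rw [e12, e1, e2, e0]; ring

omit [Fintype V] in
/-- **Negative correlation across a two-vertex separation from UPC on both sides** (`q ≤ 1`, algebra):
`N₁₂·N₀ ≤ N₁·N₂`. [cite: Grimmett2006, §3.9 (pp. 63–64)] -/
theorem twoSep_alg {X q N12 N1 N2 N0 c1 d1 C1 D1 c2 d2 C2 D2 : ℝ} (hX : 0 < X) (hq1 : q ≤ 1)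
    (e12 : X * N12 = q * (c1 * c2) + c1 * d2 + d1 * c2 + d1 * d2)
    (e1 : X * N1 = q * (c1 * C2) + c1 * D2 + d1 * C2 + d1 * D2)
    (e2 : X * N2 = q * (C1 * c2) + C1 * d2 + D1 * c2 + D1 * d2)
    (e0 : X * N0 = q * (C1 * C2) + C1 * D2 + D1 * C2 + D1 * D2)
    (u1 : d1 * C1 ≤ c1 * D1) (u2 : d2 * C2 ≤ c2 * D2) : N12 * N0 ≤ N1 * N2 := by
  have key : (X * N12) * (X * N0) ≤ (X * N1) * (X * N2) := by
    have h := twoSep_defect_eq e12 e1 e2 e0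
    nlinarith [mul_nonneg (mul_nonneg (sub_nonneg.2 hq1) (sub_nonneg.2 u1)) (sub_nonneg.2 u2)]
  have hX2 : 0 < X * X := mul_pos hX hX
  nlinarith [key]

/-! ### Negative association across a two-terminal separation with series–parallel sides -/

/-- The partition function is the network mass of the trivial event (support inside the network).
[cite: Grimmett2006, §1.4 eq. (1.20) (p. 15)] -/
theorem rcPartitionFunctionW_eq_netMass_univ (w : Sym2 V → unitInterval) (q : ℝ) {E : Set (Sym2 V)}
    (hw : ∀ e, (w e : ℝ) ≠ 0 → e ∈ E) : rcPartitionFunctionW w q ∅ = netMass w q E Set.univ := by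
  rw [← sum_rcWeightW_ind_eq_netMass w q hw Set.univ]
  unfold rcPartitionFunctionW
  exact Finset.sum_congr rfl fun ω _ => by rw [ind_of_mem (Set.mem_univ ω), mul_one]

/-- **Negative association across a two-vertex separation with series–parallel sides** (`0 < q ≤ 1`): let `E₁`, `E₂` be
two-terminal series–parallel networks between `s` and `t`, edge-disjoint, whose vertex sets meet inside `{s, t}` (so `E₁ ∪ E₂` is
their parallel composition), `w` supported in `E₁ ∪ E₂`, and `M₁`, `M₂` increasing events local to the first / second part.  Then
`φ_{w,q}(M₁ ∩ M₂) ≤ φ_{w,q}(M₁)·φ_{w,q}(M₂)`.  The defect is exactly `(1−q)` times the product of the two UPC-defects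
(`FK.twoSep_defect_eq`), each `≥ 0` by `FK.upcNet_of_isTTSP`.  (`M₂ = J_e` with `E₂ = {e}`: single-edge negative dependence.)
[cite: Grimmett2006, §3.9 (pp. 63–64)] [cite: Wagner2006, Thm. 5.8(d), §5.3] [cite: BorceaBrandenLiggett2007, Conj. 2.6] -/
theorem twoSep_negAssoc_of_isTTSP {q : ℝ} (hq0 : 0 < q) (hq1 : q ≤ 1) {E₁ E₂ : Finset (Sym2 V)} {s t : V}
    (hE₁ : IsTTSP E₁ s t) (hE₂ : IsTTSP E₂ s t) (hd : Disjoint E₁ E₂)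
    (hV : ∀ z : V, (∃ e ∈ E₁, z ∈ e) → (∃ e ∈ E₂, z ∈ e) → z = s ∨ z = t)
    (w : Sym2 V → unitInterval) (hw : ∀ e, ((w e : unitInterval) : ℝ) ≠ 0 → e ∈ (↑(E₁ ∪ E₂) : Set (Sym2 V)))
    {M₁ M₂ : Set (BondConfig V)} (hM₁u : IsUpperSet M₁) (hM₂u : IsUpperSet M₂)
    (hM₁ : ∀ η₁ η₂ : Set (Sym2 V), η₁ ⊆ ↑E₁ → η₂ ⊆ ↑E₂ → (η₁ ∪ η₂ ∈ M₁ ↔ η₁ ∈ M₁))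
    (hM₂ : ∀ η₁ η₂ : Set (Sym2 V), η₁ ⊆ ↑E₁ → η₂ ⊆ ↑E₂ → (η₁ ∪ η₂ ∈ M₂ ↔ η₂ ∈ M₂)) :
    (rcMeasureW w q ∅).real (M₁ ∩ M₂) ≤ (rcMeasureW w q ∅).real M₁ * (rcMeasureW w q ∅).real M₂ := by
  -- the parallel-composition data
  have g₁ : ∀ e ∈ (↑E₁ : Set (Sym2 V)), ∀ z ∈ e, z ∈ {z : V | ∃ e ∈ E₁, z ∈ e} := fun e he z hz => ⟨e, he, hz⟩
  have g₂ : ∀ e ∈ (↑E₂ : Set (Sym2 V)), ∀ z ∈ e, z ∈ {z : V | ∃ e ∈ E₂, z ∈ e} := fun e he z hz => ⟨e, he, hz⟩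
  have gS : {z : V | ∃ e ∈ E₁, z ∈ e} ∩ {z : V | ∃ e ∈ E₂, z ∈ e} ⊆ ({s, t} : Set V) := by
    intro z hz
    rcases hV z hz.1 hz.2 with h | h
    · exact Or.inl h
    · exact Or.inr h
  have gst : s ≠ t := hE₁.ne
  have gd : Disjoint (↑E₁ : Set (Sym2 V)) ↑E₂ := Finset.disjoint_coe.2 hd
  have hX : 0 < q ^ Fintype.card V := pow_pos hq0 _
  -- the four composite masses (fk-1 g6's two-mark parallel law)
  have e12 := netMass_parallel_two w q gd g₁ g₂ gS gst hM₁ hM₂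
  have e1 := netMass_parallel_two w q gd g₁ g₂ gS gst hM₁ (markLocal_univ₂ (↑E₁ : Set (Sym2 V)) ↑E₂)
  have e2 := netMass_parallel_two w q gd g₁ g₂ gS gst (markLocal_univ (↑E₁ : Set (Sym2 V)) ↑E₂) hM₂
  have e0 := netMass_parallel_two w q gd g₁ g₂ gS gst (markLocal_univ (↑E₁ : Set (Sym2 V)) ↑E₂)
    (markLocal_univ₂ (↑E₁ : Set (Sym2 V)) ↑E₂)
  simp only [Set.inter_univ, Set.univ_inter] at e1 e2 e0
  -- UPC on each side
  have u1 := upcNet_of_isTTSP w hq0 hE₁ M₁ hM₁u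
  have u2 := upcNet_of_isTTSP w hq0 hE₂ M₂ hM₂u
  have hle := twoSep_alg hX hq1 e12 e1 e2 e0 u1 u2
  -- back to the measure
  rw [← Finset.coe_union] at hle
  have hS : ∀ A : Set (BondConfig V), netMass w q (↑(E₁ ∪ E₂) : Set (Sym2 V)) A =
      ∑ ω : BondConfig V, rcWeightW w q ∅ ω * ind A ω := fun A => (sum_rcWeightW_ind_eq_netMass w q hw A).symm
  have hZ := rcPartitionFunctionW_pos w hq0 (∅ : Set V)
  have hZ' := rcPartitionFunctionW_eq_netMass_univ w q hw
  rw [← hZ'] at hle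
  rw [hS, hS, hS] at hle
  rw [rcMeasureW_real_eq_sum_div w hq0 ∅, rcMeasureW_real_eq_sum_div w hq0 ∅, rcMeasureW_real_eq_sum_div w hq0 ∅,
    div_mul_div_comm, div_le_div_iff₀ hZ (mul_pos hZ hZ)]
  nlinarith [hle, hZ]

end FK

end Summit.CriticalPhenomena.PercolationContinuityZ3.Theorems

end
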